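import Mathlib.Geometry.Manifold.Riemannian.Basic
import Mathlib.MeasureTheory.Measure.Hausdorff
import Mathlib.MeasureTheory.Measure.OpenPos
import Literature.Geometry.Lorentzian.Volume
import HarnessLib

/-!
# The Riemannian measure charges nonempty open sets

Companion of `Volume.lean` (the Riemannian volume `riemannianVolume h d = μHE[d]` of the length
metric of a Riemannian metric `h`, and `riemannianMeasure h = riemannianVolume h (dim)`): we prove
that on a boundaryless manifold modelled on a finite-dimensional space `E` the top-dimensional
Riemannian volume of every nonempty open set is positive (`riemannianVolume_pos_of_isOpen`), i.e.
`riemannianMeasure h` is an `IsOpenPosMeasure` (`isOpenPosMeasure_riemannianMeasure`). This is the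
property behind "`∫ f dV_h > 0` for a continuous `f ≥ 0` which does not vanish identically", used
e.g. for the sign of the mass in Schoen–Yau's conformal deformation argument
(`ConformalScalarFlat.lean`).

## Proof

* `exists_enorm_extChartAt_sub_le_mul_riemannianEDist`: the extended chart at `x` is Lipschitz
  near `x` for the Riemannian distance `riemannianEDist` (Mathlib) — the quantitative form of
  Mathlib's `setOf_riemannianEDist_lt_subset_nhds`: a `C¹` path from `y` to `z` of length close to
  `d(y, z)` stays in a neighbourhood of `x` on which the derivative of the chart is bounded by `C`
  (Mathlib's `eventually_enorm_mfderiv_extChartAt_lt`), so the chart distance of its endpoints is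
  at most `C` times its length (fundamental theorem of calculus,
  `enorm_sub_le_lintegral_derivWithin_Icc_of_contDiffOn_Icc`).
* `hausdorffMeasure_pos_of_isOpen`: Lipschitz maps expand `μH[d]` by at most `C^d`
  (`LipschitzOnWith.hausdorffMeasure_image_le`), the chart image of a neighbourhood is a
  neighbourhood in `E` (boundaryless model, `extChartAt_image_nhds_mem_nhds_of_boundaryless`), and
  `μH[dim E]` is an additive Haar measure on `E` (`isAddHaarMeasure_hausdorffMeasure`), positive on
  open sets.
* `riemannianVolume_pos_of_isOpen`, `isOpenPosMeasure_riemannianMeasure`: unfold `μHE[d]`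
  (a nonzero multiple of `μH[d]`, `addHaarScalarFactor_volume_hausdorffMeasure_ne_zero`).

## References

* H. Federer, *Geometric Measure Theory*, Springer 1969, §2.10.11 (Lipschitz maps and Hausdorff
  measure), §3.2.46 (Hausdorff measure of a Riemannian manifold is the Riemannian volume).
* D. Burago, Yu. Burago, S. Ivanov, *A course in metric geometry*, AMS 2001, §5.1 (length
  structures induced by Riemannian metrics; charts are locally bi-Lipschitz).
* I. Chavel, *Riemannian Geometry: A Modern Introduction*, 2nd ed., CUP 2006, §III.3.
-/

noncomputable section

open Manifold Bundle MeasureTheory Measure Set Filter Metric Module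
open scoped ContDiff Topology ENNReal NNReal

namespace Literature.Geometry.Lorentzian

section LipschitzChart

variable {E : Type*} [NormedAddCommGroup E] [NormedSpace ℝ E]
  {H : Type*} [TopologicalSpace H] {I : ModelWithCorners ℝ E H}
  {M : Type*} [TopologicalSpace M] [ChartedSpace H M]
  [RiemannianBundle (fun x : M ↦ TangentSpace I x)]
  [IsManifold I 1 M] [IsContinuousRiemannianBundle E (fun x : M ↦ TangentSpace I x)]

set_option backward.isDefEq.respectTransparency false in
/-- **Charts are locally Lipschitz for the Riemannian distance** (quantitative form of the
easy half of "the length-metric topology is the manifold topology"): around every point `x` of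
a `C¹` manifold whose tangent spaces carry a continuously varying inner product there are a
constant `C` and a neighbourhood `s` of `x` such that
`‖φ(y) - φ(z)‖ ≤ C · d(y, z)` for all `y, z ∈ s`, where `φ = extChartAt I x` and `d` is the
Riemannian (length) distance `riemannianEDist`. Proof: short paths from `y` to `z` stay in a
neighbourhood of `x` on which `‖Dφ‖ < C`, and the length of the image path controls the chart
distance (fundamental theorem of calculus). Burago–Burago–Ivanov, *A course in metric geometry*
(2001), §5.1; Mathlib, `setOf_riemannianEDist_lt_subset_nhds` (qualitative form). [folklore] -/
theorem exists_enorm_extChartAt_sub_le_mul_riemannianEDist [RegularSpace M] (x : M) :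
    ∃ (C : ℝ≥0) (s : Set M), s ∈ 𝓝 x ∧ ∀ y ∈ s, ∀ z ∈ s,
      ‖extChartAt I x y - extChartAt I x z‖ₑ ≤ C * riemannianEDist I y z := by
  -- the tangent spaces of the model vector space `E` carry the norm of `E` (Mathlib's
  -- non-instance `normedAddCommGroupTangentSpaceVectorSpace`, activated locally)
  letI _i₁ : (p : E) → NormedAddCommGroup (TangentSpace 𝓘(ℝ, E) p) := fun p ↦
    normedAddCommGroupTangentSpaceVectorSpace p
  letI _i₂ : (p : E) → NormedSpace ℝ (TangentSpace 𝓘(ℝ, E) p) := fun p ↦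
    normedSpaceTangentSpaceVectorSpace p
  -- a neighbourhood of `x` inside the chart domain on which the derivative of the chart is `< C`
  rcases eventually_enorm_mfderiv_extChartAt_lt I x with ⟨C, C_pos, hC⟩
  obtain ⟨u, u_mem, hu, uc⟩ : ∃ u ∈ 𝓝 x,
      u ⊆ {y | ‖mfderiv% (extChartAt I x) y‖ₑ < C} ∧ u ⊆ (extChartAt I x).source := by
    refine ⟨_, inter_mem hC (extChartAt_source_mem_nhds (I := I) x), inter_subset_left,
      inter_subset_right⟩
  have uc' : u ⊆ (chartAt H x).source := by simpa [extChartAt_source I x] using uc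
  -- it contains a Riemannian ball `{d(x, ·) < c}`
  obtain ⟨c, c_pos, hc⟩ := setOf_riemannianEDist_lt_subset_nhds' I u_mem
  have c2_pos : (0 : ℝ≥0∞) < c / 2 := ENNReal.div_pos c_pos.ne' ENNReal.ofNat_ne_top
  have c4_pos : (0 : ℝ≥0∞) < c / 2 / 2 := ENNReal.div_pos c2_pos.ne' ENNReal.ofNat_ne_top
  refine ⟨C, {y | riemannianEDist I x y < c / 2 / 2}, eventually_riemannianEDist_lt I x c4_pos,
    ?_⟩
  intro y hy z hz
  -- main estimate: a path from `y` to `z` of length `< r ≤ c / 2` stays inside `u`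
  have key : ∀ r, riemannianEDist I y z < r → r ≤ c / 2 →
      ‖extChartAt I x y - extChartAt I x z‖ₑ ≤ C * r := by
    intro r hr hrc
    rcases exists_lt_locally_constant_of_riemannianEDist_lt hr zero_lt_one with
      ⟨γ, hγy, hγz, γ_smooth, hγ, -⟩
    -- the path stays in `u`
    have hγu : ∀ t ∈ Icc (0 : ℝ) 1, γ t ∈ u := by
      intro t ht
      apply hc
      simp only [mem_setOf_eq]
      have h1 : riemannianEDist I y (γ t) ≤ pathELength I γ 0 t :=
        riemannianEDist_le_pathELength (γ_smooth.contMDiffOn (s := Icc 0 t)) hγy rfl ht.1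
      have h2 : pathELength I γ 0 t ≤ pathELength I γ 0 1 := pathELength_mono le_rfl ht.2
      calc riemannianEDist I x (γ t)
          ≤ riemannianEDist I x y + riemannianEDist I y (γ t) := riemannianEDist_triangle
        _ < c / 2 / 2 + c / 2 := by
            refine ENNReal.add_lt_add hy ?_
            exact (h1.trans h2).trans_lt (hγ.trans_le hrc)
        _ ≤ c / 2 + c / 2 := by
            gcongr
            exact ENNReal.half_le_self
        _ = c := ENNReal.add_halves c
    -- the image path
    let γ' := extChartAt I x ∘ γ
    have hC' : CMDiff[Icc 0 1] 1 γ' :=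
      contMDiffOn_extChartAt.comp (I' := I) (t := (chartAt H x).source)
        γ_smooth.contMDiffOn (fun t ht ↦ uc' (hγu t ht))
    calc ‖extChartAt I x y - extChartAt I x z‖ₑ
        = ‖γ' 1 - γ' 0‖ₑ := by
          rw [enorm_sub_rev]
          simp [γ', hγy, hγz]
      _ ≤ ∫⁻ t in Icc (0 : ℝ) 1, ‖derivWithin γ' (Icc 0 1) t‖ₑ := by
          apply enorm_sub_le_lintegral_derivWithin_Icc_of_contDiffOn_Icc _ zero_le_one
          rwa [← contMDiffOn_iff_contDiffOn]
      _ = ∫⁻ t in Icc (0 : ℝ) 1, ‖mfderiv[Icc 0 1] γ' t 1‖ₑ := by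
          simp_rw [← fderivWithin_derivWithin, mfderivWithin_eq_fderivWithin]
          rfl
      _ ≤ ∫⁻ t in Icc (0 : ℝ) 1, C * ‖mfderiv[Icc 0 1] γ t 1‖ₑ := by
          apply setLIntegral_mono' measurableSet_Icc (fun t ht ↦ ?_)
          have hcomp : mfderiv[Icc 0 1] γ' t =
              (mfderiv% (extChartAt I x) (γ t)) ∘L (mfderiv[Icc 0 1] γ t) := by
            apply mfderiv_comp_mfderivWithin
            · exact mdifferentiableAt_extChartAt (uc' (hγu t ht))
            · exact (γ_smooth.mdifferentiable one_ne_zero).mdifferentiableOn _ ht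
            · rw [uniqueMDiffWithinAt_iff_uniqueDiffWithinAt]
              exact uniqueDiffOn_Icc zero_lt_one _ ht
          have hcomp1 : mfderiv[Icc 0 1] γ' t 1 =
              (mfderiv% (extChartAt I x) (γ t)) (mfderiv[Icc 0 1] γ t 1) :=
            congr($hcomp 1)
          rw [hcomp1]
          apply (ContinuousLinearMap.le_opENorm _ _).trans
          gcongr
          exact (hu (hγu t ht)).le
      _ = C * pathELength I γ 0 1 := by
          rw [lintegral_const_mul' _ _ ENNReal.coe_ne_top,
            pathELength_eq_lintegral_mfderivWithin_Icc]
      _ ≤ C * r := by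
          gcongr
  -- letting `r ↓ d(y, z)`
  have hd : riemannianEDist I y z < c / 2 := by
    calc riemannianEDist I y z
        ≤ riemannianEDist I y x + riemannianEDist I x z := riemannianEDist_triangle
      _ < c / 2 / 2 + c / 2 / 2 := by
          refine ENNReal.add_lt_add ?_ hz
          rw [riemannianEDist_comm]
          exact hy
      _ = c / 2 := ENNReal.add_halves (c / 2)
  obtain ⟨r₀, hr₀, hr₀c⟩ := exists_between hd
  have hC0 : (C : ℝ≥0∞) ≠ 0 := by exact_mod_cast C_pos.ne'
  have hdiv : ‖extChartAt I x y - extChartAt I x z‖ₑ / C ≤ riemannianEDist I y z := by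
    refine le_of_forall_gt_imp_ge_of_dense fun r hr ↦ ?_
    have h := key (min r r₀) (lt_min hr hr₀) ((min_le_right _ _).trans hr₀c.le)
    calc ‖extChartAt I x y - extChartAt I x z‖ₑ / C ≤ min r r₀ := ENNReal.div_le_of_le_mul' h
      _ ≤ r := min_le_left _ _
  calc ‖extChartAt I x y - extChartAt I x z‖ₑ
      = C * (‖extChartAt I x y - extChartAt I x z‖ₑ / C) := by
        rw [ENNReal.mul_div_cancel hC0 ENNReal.coe_ne_top]
    _ ≤ C * riemannianEDist I y z := by gcongr

/-- **The Hausdorff measure of the Riemannian length metric charges open sets.** On a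
boundaryless `C¹` manifold of dimension `d = dim E` whose tangent spaces carry a continuously
varying inner product, endowed with the length (e)metric `EMetricSpace.ofRiemannianMetric`, every
nonempty open set has positive `d`-dimensional Hausdorff measure: a chart is Lipschitz near a
point of the set for the length distance (`exists_enorm_extChartAt_sub_le_mul_riemannianEDist`),
Lipschitz maps increase `μH[d]` at most by a factor (`LipschitzOnWith.hausdorffMeasure_image_le`),
and the chart image is a neighbourhood in `E`, of positive Lebesgue = `μH[d]` measure. Federer,
*Geometric Measure Theory* (1969), §2.10.11 and §3.2.46. [cite: Federer1969, §2.10.11 and §3.2.46] -/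
theorem hausdorffMeasure_pos_of_isOpen [T3Space M] [MeasurableSpace M] [BorelSpace M]
    [I.Boundaryless] [FiniteDimensional ℝ E] {U : Set M} (hU : IsOpen U) (hne : U.Nonempty) :
    letI := EMetricSpace.ofRiemannianMetric I M
    0 < (μH[finrank ℝ E] : Measure M) U := by
  letI := EMetricSpace.ofRiemannianMetric I M
  obtain ⟨x, hx⟩ := hne
  obtain ⟨C, s, hs, hLip⟩ := exists_enorm_extChartAt_sub_le_mul_riemannianEDist (I := I) x
  have hL : LipschitzOnWith C (extChartAt I x) (s ∩ U) := by
    intro y hy z hz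
    rw [edist_eq_enorm_sub]
    exact hLip y hy.1 z hz.1
  letI : MeasurableSpace E := borel E
  haveI : BorelSpace E := ⟨rfl⟩
  have h1 := hL.hausdorffMeasure_image_le (d := finrank ℝ E) (Nat.cast_nonneg _)
  have h2 : 0 < (μH[finrank ℝ E] : Measure E) (extChartAt I x '' (s ∩ U)) :=
    measure_pos_of_mem_nhds _
      (extChartAt_image_nhds_mem_nhds_of_boundaryless (inter_mem hs (hU.mem_nhds hx)))
  have h3 : 0 < (μH[finrank ℝ E] : Measure M) (s ∩ U) :=
    (ENNReal.mul_pos_iff.1 (h2.trans_le h1)).2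
  exact h3.trans_le (measure_mono inter_subset_right)

end LipschitzChart

section Volume

variable {E : Type*} [NormedAddCommGroup E] [NormedSpace ℝ E]
  {H : Type*} [TopologicalSpace H] {I : ModelWithCorners ℝ E H} {n : ℕ∞ω}
  {N : Type*} [TopologicalSpace N] [ChartedSpace H N] [IsManifold I 1 N] [T3Space N]
  [MeasurableSpace N] [BorelSpace N]

/-- **The Riemannian measure charges nonempty open sets**: for a `C^n` Riemannian metric `h`
on a boundaryless manifold `N` of dimension `dim E`, every nonempty open `U ⊆ N` has
`0 < riemannianVolume h (dim E) U` (the top-dimensional Euclidean-normalised Hausdorff measure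
of the length metric; in charts `dvol_h = √(det h_{ij}) dy` has a positive density). Federer 1969,
§3.2.46; Chavel 2006, §III.3. [cite: Federer1969, §3.2.46] -/
theorem riemannianVolume_pos_of_isOpen [I.Boundaryless] [FiniteDimensional ℝ E]
    (h : ContMDiffRiemannianMetric I n E (TangentSpace I : N → Type _)) {U : Set N}
    (hU : IsOpen U) (hne : U.Nonempty) : 0 < riemannianVolume h (finrank ℝ E) U := by
  letI : RiemannianBundle (fun x : N ↦ TangentSpace I x) :=
    ⟨h.toContinuousRiemannianMetric.toRiemannianMetric⟩
  letI : EMetricSpace N := EMetricSpace.ofRiemannianMetric I N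
  show 0 < (μHE[finrank ℝ E] : Measure N) U
  rw [Measure.euclideanHausdorffMeasure_def, Measure.smul_apply, ENNReal.smul_def, smul_eq_mul]
  refine ENNReal.mul_pos ?_ (hausdorffMeasure_pos_of_isOpen (I := I) hU hne).ne'
  exact ENNReal.coe_ne_zero.2 (addHaarScalarFactor_volume_hausdorffMeasure_ne_zero _)

/-- **The Riemannian measure is positive on nonempty open sets** (`IsOpenPosMeasure`), for a
`C^n` Riemannian metric on a boundaryless manifold modelled on the finite-dimensional space `E`
(`riemannianMeasure h = riemannianVolume h (dim E)`). Federer 1969, §3.2.46; Chavel 2006,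
§III.3. [cite: Federer1969, §3.2.46] -/
theorem isOpenPosMeasure_riemannianMeasure [I.Boundaryless] [FiniteDimensional ℝ E]
    (h : ContMDiffRiemannianMetric I n E (TangentSpace I : N → Type _)) :
    (riemannianMeasure h).IsOpenPosMeasure :=
  ⟨fun _U hU hne ↦ (riemannianVolume_pos_of_isOpen h hU hne).ne'⟩

end Volume

end Literature.Geometry.Lorentzian

end
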